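/-
Copyright (c) 2026 the pub-hodgecm-mathlib formalisation cell (harness21).  Prover seat hodgecm-mathlib-K2E3-p37 (g2), Track B «K2-LIT» ∕ h413 =
`stmt-HodgeConjecture-24833`, line `K2_E3_EllipticInputs`, unit U4 «Keys», PART «U4Keys» socket :182 (U4f-χ₁-ram-one-pos)
`sig_K2E3KeysThmTwoContractingRamifiedCharOnePosDepth` (L4 line-lead K2E3-plan (g5); programme A_pos^{=}): brick (iii)-T-LETTER «THE PLACE-FREE TRACE-ONE LETTER
`hT` — its SOURCES and its SCOPE».  `hT : ∃ t : L ⊗ L⁺_v, t + (c ⊗ 1) t = 1 ∧ ∀ w′, |t_{w′}| ≤ 1` is the letter under which ★ p862401 makes the intermediate cells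
θ-irrelevant; this file proves it from «`|2|_w = 1`» and from «`v` unramified in `L`» (★ `Rogawski1990.exists_valued_galAdicCompletionMap_sub_eq_one`), and shows that
at a RAMIFIED place it forces `|2|_w = 1` (★ `RamifiedPlaceDifferent` §6) — so its only failures are the wildly ramified dyadic places.  REPORT-FIRST 2026-09-04.
-/
import Summits.HodgeConjecture.HodgeConjecture.Theorems.K2E3LevelNDepthWitnessTraceOne   -- ★ p862372 (this seat): `exists_traceOne_of_v_two_eq_one`, `exists_traceOne_of_v_sub_conj_eq_one` (model `K`, involution `σ`)
import Literature.NumberTheory.Rogawski1990.RankOneUnstableDeltaValueInert                -- ★ `exists_valued_galAdicCompletionMap_sub_eq_one` (unramified inert place: an integral `a₀` moved by a unit)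
import Literature.NumberTheory.Automorphic.RamifiedPlaceDifferent                        -- ★ F0P3a-p06 (g18): `valued_galAdicCompletionMap_sub_self_le_of_mem_integer`, `valued_galAdicCompletionMap_sub_self_le_exp_neg_one` (ramified: `σ_w ≡ id mod 𝔭_w`)
import Literature.NumberTheory.Automorphic.AnisotropicUnitaryGroupCompactOfPlace          -- ★ `conjLocal_apply_eq_of_smul_eq` (`((c ⊗ 1) t)_w = σ_w (t_w)` at a non-split place); brings ★ `PlacesOver.eq_of_smul_eq`
import Literature.NumberTheory.Automorphic.UnitaryGroupInertPlaceHyperbolicBasis          -- ★ `galAdicCompletionMap_galAdicCompletionMap_of_smul_eq` (`σ_w σ_w = 1`)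
import HarnessLib

/-!
# K2 ∕ E3 «EllipticInputs», unit U4 «Keys» — (U4f-χ₁-ram-one-pos), programme A_pos^{=} brick (iii)-T-LETTER: THE PLACE-FREE TRACE-ONE LETTER, ITS SOURCES AND ITS SCOPE
# «`L ⊗ L⁺_v` has an integral element of trace one» ⟸ `|2|_w = 1` ∨ `v` unramified in `L`;  ⟹ `|2|_w = 1` at a ramified `w`   [Serre1979 III §3, IV §1–§2, V §2; CasselsFröhlich1967 VII §1]

Cell hodgecm-mathlib, Track B «K2-LIT», crux item H413 = stmt-HodgeConjecture-24833 (route `HCCMUnconditional`, no route verbs); target BY NAME the OPEN tier-0 leaf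
`…K2E3EllipticInputs.U4Keys.sig_K2E3KeysThmTwoContractingRamifiedCharOnePosDepth` (U4Keys ED. 8 :182), design D-I «vanishing functional» at POSITIVE depth.
Author K2E3-p37 (g2).  `--supports stmt-HodgeConjecture-24833 --as helper`; THEOREMS ONLY.  NOT THE PAYER.

THE POINT.  ★ p862401 `K2E3LevelNDepthWitnessCMTraceOne` kills the intermediate cells of the level-`(m+1)` Iwahori decomposition under the frame letter «`t ∈ L_w`, `t + σ_w t = 1`,
`|t|_w ≤ 1`», and reads that letter off the PLACE-FREE one
  `hT : ∃ t : LocalRing L v, t + conjLocal L c v t = 1 ∧ ∀ w′, Valued.v (t w′) ≤ 1`   (`LocalRing L v = Π_{w′ ∣ v} L_{w′} = L ⊗ L⁺_v`, `conjLocal = c ⊗ 1`),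
which is the spelling a frame-free socket ∕ leaf can carry.  This file supplies, at a non-split `v` (`c • w = w`):
* §1 `exists_traceOne_local_of_traceOne_adic` — frame ⟹ place-free (the converse of ★ p862401 §3; `t := update 0 w t₀`, `w` the only place above `v`);
* §2 THE TWO SOURCES: `exists_traceOne_local_of_v_two_eq_one` (`|2|_w = 1`, `t_w = ½`) and **`exists_traceOne_local_of_isUnramifiedIn`** (`v` unramified in `L`, DYADIC INCLUDED:
  ★ `Rogawski1990.exists_valued_galAdicCompletionMap_sub_eq_one` gives an integral `a₀` with `|σ_w a₀ − a₀| = 1`, and `t_w = a₀ ∕ (a₀ − σ_w a₀)` by ★ p862372 §3), with the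
  `hns`-quantified corollaries `…_of_nonsplit` a frame-free leaf consumes directly;
* §3 THE SCOPE: `valued_two_eq_one_of_ramified_of_traceOne` — at a RAMIFIED `w` a trace-one integer forces `|2|_w = 1` (`σ_w t − t = 1 − 2t` has `|·| ≤ |σ_wτ − τ| < 1` by ★
  `RamifiedPlaceDifferent` §6, impossible if `|2t| < 1`).  Hence `hT` holds EXACTLY off the wildly ramified dyadic places: a pos-A⁼ socket cut with `hT` is the widest statement
  the uniform-`J_n` programme (★ p861548 … ★ p862401) pays, and strictly wider than «`v` non-dyadic».
HONEST LABEL: HC_CM is proved only modulo the 7 printed citations (2 remaining named inputs: hLiu418 = stmt-HodgeConjecture-24832, h413 = stmt-HodgeConjecture-24833)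
until rung 0 closes; count-neutral — this file does NOT pay the leaf; no printed citation is discharged.

## References
* [Serre1979] J.-P. Serre, *Local Fields*, GTM 67 (1979), Ch. III §3 (trace and different), Ch. IV §1 Prop. 4 – §2 (`i_G(σ) = ord(στ − τ)`), Ch. V §2 Prop. 3 (unramified: trace onto).
* [CasselsFrohlichANT1967] J. W. S. Cassels, A. Fröhlich (eds.), *Algebraic Number Theory* (1967), Ch. II §10–§11 (`L ⊗_K K_v = Π L_w`), Ch. VII §1.1, Prop. 1.2.
* [Rogawski1990] J. D. Rogawski, *Automorphic Representations of Unitary Groups in Three Variables*, Ann. of Math. Stud. 123 (1990), §1.10 p. 9, §12.1 p. 171.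
-/

set_option autoImplicit false
-- the mandated namespace repeats the single-problem summit's segment (`HodgeConjecture.HodgeConjecture`)
set_option linter.dupNamespace false

noncomputable section

open NumberField IsDedekindDomain
open scoped WithZero Valued
open Literature.NumberTheory Literature.NumberTheory.Automorphic Literature.NumberTheory.Automorphic.UnitaryGroup

namespace Summit.HodgeConjecture.HodgeConjecture.Cruxes.H413.K2E3LocalTraceOneLetter

open Summit.HodgeConjecture.HodgeConjecture.Cruxes.H413

variable (L : Type) [Field L] [NumberField L] [IsCMField L] (v : HeightOneSpectrum (𝓞 ↥(maximalRealSubfield L)))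
  (w : PlacesOver L v) (hw : IsCMField.complexConj L • w.1 = w.1)

/-! ## §1 Frame letter ⟹ place-free letter -/

/-- **From the frame letter at `w` to the place-free letter**: at a non-split `v`, `w` is the only place above `v` (★ `PlacesOver.eq_of_smul_eq`), so a trace-one integer
`t₀ ∈ L_w` (`t₀ + σ_w t₀ = 1`, `|t₀|_w ≤ 1`) IS an integral element `t` of `L ⊗ L⁺_v` with `t + (c ⊗ 1) t = 1` (`((c ⊗ 1) t)_w = σ_w (t_w)`, ★ `conjLocal_apply_eq_of_smul_eq`).
[cite: CasselsFrohlichANT1967, Ch. VII §1.1, Prop. 1.2] -/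
theorem exists_traceOne_local_of_traceOne_adic {t₀ : w.1.adicCompletion L}
    (ht₀ : t₀ + galAdicCompletionMap (L := L) (IsCMField.complexConj L) hw t₀ = 1) (hvt₀ : Valued.v t₀ ≤ 1) :
    ∃ t : LocalRing L v, t + conjLocal L (IsCMField.complexConj L) v t = 1 ∧ ∀ w' : PlacesOver L v, Valued.v (t w') ≤ 1 := by
  classical
  refine ⟨Function.update 0 w t₀, ?_, fun w' => ?_⟩
  · funext w'
    obtain rfl := (PlacesOver.eq_of_smul_eq (IsCMField.complexConj L) (IsCMField.complexConj_ne_one L) w hw w').symm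
    rw [Pi.add_apply, Pi.one_apply, conjLocal_apply_eq_of_smul_eq (IsCMField.complexConj L) (IsCMField.complexConj_ne_one L) v w hw,
      Function.update_self]
    exact ht₀
  · obtain rfl := (PlacesOver.eq_of_smul_eq (IsCMField.complexConj L) (IsCMField.complexConj_ne_one L) w hw w').symm
    rw [Function.update_self]
    exact hvt₀

/-! ## §2 The two sources: `|2|_w = 1`, and `v` unramified in `L` -/

include hw in
/-- **Source 1 — non-dyadic `w`**: `|2|_w = 1` gives `t_w = 2⁻¹` (★ p862372 `exists_traceOne_of_v_two_eq_one`). [cite: Serre1979, Ch. III §3] -/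
theorem exists_traceOne_local_of_v_two_eq_one (h2 : Valued.v (2 : w.1.adicCompletion L) = 1) :
    ∃ t : LocalRing L v, t + conjLocal L (IsCMField.complexConj L) v t = 1 ∧ ∀ w' : PlacesOver L v, Valued.v (t w') ≤ 1 := by
  obtain ⟨t₀, ht₀, hvt₀⟩ :=
    K2E3LevelNDepthWitnessTraceOne.exists_traceOne_of_v_two_eq_one (galAdicCompletionMap (L := L) (IsCMField.complexConj L) hw) h2
  exact exists_traceOne_local_of_traceOne_adic L v w hw ht₀ hvt₀

include hw in
/-- **Source 2 — `v` UNRAMIFIED in `L` (dyadic places included)**: the residual involution of `k_w ∕ k_v` is non-trivial, so some integral `a₀ ∈ L_w` has `|σ_w a₀ − a₀|_w = 1`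
(★ `Rogawski1990.exists_valued_galAdicCompletionMap_sub_eq_one`), and `t_w := a₀ ∕ (a₀ − σ_w a₀)` is a trace-one integer (★ p862372 `exists_traceOne_of_v_sub_conj_eq_one`):
`Tr_{L_w ∕ L⁺_v}(𝒪_w) = 𝒪_v`. [cite: Serre1979, Ch. V §2 Prop. 3, Ch. III §3] -/
theorem exists_traceOne_local_of_isUnramifiedIn (hunr : Algebra.IsUnramifiedIn (𝓞 L) v.asIdeal) :
    ∃ t : LocalRing L v, t + conjLocal L (IsCMField.complexConj L) v t = 1 ∧ ∀ w' : PlacesOver L v, Valued.v (t w') ≤ 1 := by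
  obtain ⟨a₀, ha₀, hσa₀⟩ := Literature.NumberTheory.Rogawski1990.exists_valued_galAdicCompletionMap_sub_eq_one L v w hw hunr
  have hσσ := galAdicCompletionMap_galAdicCompletionMap_of_smul_eq (IsCMField.complexConj L) w (IsCMField.complexConj_ne_one L) hw
  rw [Valuation.map_sub_swap] at hσa₀
  obtain ⟨t₀, ht₀, hvt₀⟩ :=
    K2E3LevelNDepthWitnessTraceOne.exists_traceOne_of_v_sub_conj_eq_one (galAdicCompletionMap (L := L) (IsCMField.complexConj L) hw) hσσ ha₀ hσa₀
  exact exists_traceOne_local_of_traceOne_adic L v w hw ht₀ hvt₀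

/-- **Source 2, frame-free** (the form a leaf quantified over `hns : ∀ w, c • w = w` consumes): `v` non-split and unramified in `L` ⟹ the place-free trace-one letter.
[cite: Serre1979, Ch. V §2 Prop. 3] [cite: CasselsFrohlichANT1967, Ch. VII Prop. 1.2] -/
theorem exists_traceOne_local_of_isUnramifiedIn_of_nonsplit (hns : ∀ w' : PlacesOver L v, IsCMField.complexConj L • w'.1 = w'.1)
    (hunr : Algebra.IsUnramifiedIn (𝓞 L) v.asIdeal) :
    ∃ t : LocalRing L v, t + conjLocal L (IsCMField.complexConj L) v t = 1 ∧ ∀ w' : PlacesOver L v, Valued.v (t w') ≤ 1 := by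
  obtain ⟨w₁⟩ := (inferInstance : Nonempty (PlacesOver L v))
  exact exists_traceOne_local_of_isUnramifiedIn L v w₁ (hns w₁) hunr

/-- **Source 1, frame-free**: `v` non-split and `|2|_{w′} = 1` at some (equivalently every) `w′ ∣ v` ⟹ the place-free trace-one letter. [cite: Serre1979, Ch. III §3] -/
theorem exists_traceOne_local_of_v_two_eq_one_of_nonsplit (hns : ∀ w' : PlacesOver L v, IsCMField.complexConj L • w'.1 = w'.1)
    (h2 : ∀ w' : PlacesOver L v, Valued.v (2 : w'.1.adicCompletion L) = 1) :
    ∃ t : LocalRing L v, t + conjLocal L (IsCMField.complexConj L) v t = 1 ∧ ∀ w' : PlacesOver L v, Valued.v (t w') ≤ 1 := by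
  obtain ⟨w₁⟩ := (inferInstance : Nonempty (PlacesOver L v))
  exact exists_traceOne_local_of_v_two_eq_one L v w₁ (hns w₁) (h2 w₁)

/-! ## §3 The scope: at a ramified place a trace-one integer forces `|2|_w = 1` -/

include hw in
/-- **SCOPE — no trace-one integer at a wildly ramified dyadic place.**  If `w ∣ v` is RAMIFIED and `t ∈ L_w` has `t + σ_w t = 1`, `|t|_w ≤ 1`, then `|2|_w = 1`: indeed
`σ_w t − t = 1 − 2t`, and `|σ_w t − t| ≤ |σ_w τ − τ| ≤ exp(−1) < 1` for a uniformiser `τ` (★ `RamifiedPlaceDifferent` §6: `σ_w ≡ id (mod 𝔭_w^d)`, `d ≥ 1`), which is absurd when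
`|2t| < 1` (then `|1 − 2t| = 1`); so `|2t| = 1`, i.e. `|2|_w = |t|_w = 1`.  With §2 this pins the letter `hT` down: it holds at every `v` EXCEPT the wildly ramified dyadic ones.
[cite: Serre1979, Ch. IV §1 Prop. 4, Ch. IV §2, Ch. III §3] -/
theorem valued_two_eq_one_of_ramified_of_traceOne (he : v.asIdeal.ramificationIdx' w.1.asIdeal ≠ 1) {t : w.1.adicCompletion L}
    (ht : t + galAdicCompletionMap (L := L) (IsCMField.complexConj L) hw t = 1) (hvt : Valued.v t ≤ 1) :
    Valued.v (2 : w.1.adicCompletion L) = 1 := by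
  obtain ⟨π, hπ⟩ := w.1.valuation_exists_uniformizer L
  have hτ : Valued.v (π : w.1.adicCompletion L) = WithZero.exp (-1 : ℤ) := by rw [HeightOneSpectrum.valuedAdicCompletion_eq_valuation', hπ]
  -- `|σ t − t| < 1`
  have hlt : Valued.v (galAdicCompletionMap (L := L) (IsCMField.complexConj L) hw t - t) < 1 :=
    lt_of_le_of_lt ((valued_galAdicCompletionMap_sub_self_le_of_mem_integer L v w hw he hτ hvt).trans
      (valued_galAdicCompletionMap_sub_self_le_exp_neg_one L v w hw hτ)) (by rw [← WithZero.exp_zero, WithZero.exp_lt_exp]; norm_num)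
  -- `σ t − t = 1 − 2t`
  have hst : galAdicCompletionMap (L := L) (IsCMField.complexConj L) hw t - t = 1 - 2 * t := by linear_combination ht
  rw [hst] at hlt
  -- `|2| ≤ 1`, `|2t| ≤ 1`; if `|2t| < 1` then `|1 − 2t| = 1`, absurd
  have h2le : Valued.v (2 : w.1.adicCompletion L) ≤ 1 := by
    have h := Valued.v.map_add_le (le_refl (Valued.v (1 : w.1.adicCompletion L))) (le_refl (Valued.v (1 : w.1.adicCompletion L)))
    rwa [one_add_one_eq_two, Valuation.map_one] at h
  have h2t : Valued.v (2 * t) = 1 := by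
    refine (le_antisymm (by rw [map_mul]; exact mul_le_one' h2le hvt) ?_)
    by_contra hlt'
    rw [not_le] at hlt'
    have h1 : Valued.v (1 - 2 * t) = 1 := Valuation.map_one_sub_of_lt _ hlt'
    rw [h1] at hlt
    exact lt_irrefl _ hlt
  -- `|2|·|t| = 1` with both `≤ 1` ⟹ `|2| = 1`
  rw [map_mul] at h2t
  refine le_antisymm h2le ?_
  by_contra h
  rw [not_le] at h
  have : Valued.v (2 : w.1.adicCompletion L) * Valued.v t < 1 := by
    calc Valued.v (2 : w.1.adicCompletion L) * Valued.v t ≤ Valued.v (2 : w.1.adicCompletion L) * 1 := mul_le_mul' le_rfl hvt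
      _ = Valued.v (2 : w.1.adicCompletion L) := mul_one _
      _ < 1 := h
  rw [h2t] at this
  exact lt_irrefl _ this

end Summit.HodgeConjecture.HodgeConjecture.Cruxes.H413.K2E3LocalTraceOneLetter

end
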